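import Summits.ABC.IUTFork.Joshi.ArithmeticoidProperties
import Summits.ABC.IUTFork.Joshi.ArithmeticoidPeriods
import Mathlib.FieldTheory.IsAlgClosed.Basic
import Mathlib.NumberTheory.NumberField.AdeleRing

/-!
# Joshi, *ATS II½ — Deformations of Number Fields* (arXiv:2305.10398) §5, co-typed remainder I: Lem. 5.1.2, tilts of arithmeticoids
# (Def. 5.1.7, Prop. 5.1.8), Rmk. 5.2.2, Prop. 5.5.1, deformations of a number field (Def. 5.8.1), Rmk. 5.9.2, Rmk. 5.10.2, Thm. 5.11.1,
# Thm. 5.12.1 — typed, no side taken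

Co-typer companion of seat abc-iut-E-t37's `Joshi/Arithmeticoids.lean` (p430482), `Joshi/ArithmeticoidProperties.lean` (p430871) and
`Joshi/ArithmeticoidPeriods.lean` (p430897) — block E of the abc-iut cell, rung LADDER-ABC:A2.E, seat abc-iut-E-t46 (BATCH-3 slot book 07:46Z: the
§5 rows of the [J-2½] in-scope remainder; inventory `HOME/plan/E/t46/INVENTORY.tsv`; sequel `Joshi/ArithmeticoidFrobenioids.lean` = Thm. 5.13.1,
Def. 5.14.2, Prop. 5.15.1, §5.16). Same source, render and conventions as those files: [J-2½] = K. Joshi, *Construction of Arithmetic Teichmuller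
Spaces II½: Deformations of Number Fields*, unrefereed arXiv preprint 2305.10398 («Preliminary version for comments»), lit key
`paper:arxiv-2305.10398`, bib `Joshi2023ATS2half`; «p.N l.M» = line M of `HOME/plan/repair/lit/renders/Joshi-arxiv-2305.10398-ATS2half/pNNNN.txt`
(PDF page N). TAKES NO SIDE on [IUTchIII] Cor. 3.12, on Joshi's claims, or on Mochizuki's reports on them; typed ≠ proved; typed AS A CANDIDATE ≠
endorsed. Every statement print ASSERTS is a `def … : Prop` carrying `@[claim "Joshi2023ATS2half" "disputed"]` («disputed» records that a dispute
exists in print; no side), never an axiom / instance / theorem; DATA print defines is a `structure` / `def` AS PRINTED; what FOLLOWS from the typed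
signatures is a `theorem` (a DISCHARGED row). E-t37's carriers (`DeformationDatum`, `Arith`, `arithRing`, `iotaL`, `iota`, `TopEquivalent`,
`adeloid`, `ideloid`, `iotaUnits`, `periodMap`, `hyperplane`, `Lone`, `unitAction`, `LActsByFrobeniusPowers`, `prod_formula_normalized`) are
imported BY NAME; nothing of theirs is restated.

CONTENTS (node ids of `HOME/plan/E/JOSHI-DAG.tsv`):
* J2h:Lem5.1.2 `lem512` (DERIVED: with modelling choice (e) of p430482 — a point of `|Y_{F_v,L_v}|` IS an isomorphism class of untilts —
  «isomorphism of untilts at every `v`» reads «equality of every component»). J2h:Rmk5.1.4 / J2h:Rmk5.1.6: docstrings of `Deformation` / `thm5111`.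
* J2h:Def5.1.7 — the TILT SIGNATURE `TiltDatum` (the tilting data `K^♭_{y_v} ≃ F_v = L̂^♭_v` of Def. 5.1.1, which p430482 deliberately does not
  record) and `TiltDatum.tilt y = R^♭_y = ∏_v K^♭_{y_v}`; note (2) «characteristic zero» DERIVED (`tilt_charZero`) from print's reason (factors of
  unboundedly many prime characteristics). J2h:Prop5.1.8 DERIVED (`tiltEquiv`, `prop518`). J2h:Rmk5.2.2 (1) DERIVED (`ne_of_not_topEquivalent`);
  (2)–(4) docstring.
* J2h:Prop5.5.1 `Prop551_1` / `Prop551_2` (claims, over Mathlib's `NumberField.AdeleRing`; (3) prose) — LOCATED: print gives no construction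
  («clear from the definitions»).
* J2h:Def5.8.1 `Deformation` (packaging: the arithmeticoid with `ι_L`, `ι_{L̄}`, adeloid, ideloid, `G_L`, `𝔾_L`, (5.8.2)) and `deformationOf`
  (DERIVED construction: `ι_{L̄}` exists because every `K_{y_v}` is algebraically closed, Def. 5.1.1 — `IsAlgClosed.lift`). J2h:Rmk5.8.3 docstring.
* J2h:Rmk5.9.2 `Lone_unitAction` (DERIVED modulo the claim `LActsByFrobeniusPowers` = Thm. 4.2.3 (4): `L ↦ L^{(1)}` commutes with `L* ↷ 𝒴_L`).
* J2h:Rmk5.10.2 `periodTuple` (the `ℓ*`-tuples `(H_{y_1}, …, H_{y_{ℓ*}})` of (2)), with (3)–(5) recorded verbatim as an E6 / barrier LOCATOR —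
  no adjudication.
* J2h:Thm5.11.1 `thm5111` (DERIVED, the three variants), J2h:Rmk5.11.2 docstring.
* J2h:Thm5.12.1 (1)/(2) `embeddedL`, `embeddedLEquiv`, `thm5121_1`, `thm5121_1_units`, `embeddedLv`, `thm5121_2` (the isomorphisms DERIVED —
  in the signature they come from the common source `L` / `L_v`; print grounds them in `G_L`-amphoricity [Hoshi 2015], LOCATED), the topological
  clause of (2) as the claim `Thm5121_2_top`; (3)/(4)/(5) = E-t37's `LocalTopInequivalent` / `Thm552_7` / `arith_metrizable` (docstring).
  J2h:Rmk5.12.2 docstring.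
OUR SIDE: nothing here mentions the Cor. 3.12 vocabulary (E-PLAN R14: only `Joshi/Dictionary*.lean` / `Joshi/Test*.lean` bind our frozen objects).
Nearest typed objects BY NAME (docstrings only): seat E-t38's `Summit.ABC.IUTFork.Joshi.ATS2half.Thm621` (Thm. 6.2.1, p430039) and
`…ATS2half.Prop422` / `GlobalGaloisIsomorphic` (`Joshi/ArithmeticoidGaloisAmphoric.lean`); seat E-t7's [J-III] Thm. 4.2.2.1 scaling
(`Joshi/AdelicAnsatzScaling.lean`).
-/

noncomputable section

open TopologicalSpace

namespace Summit.ABC.IUTFork.Joshi.ATS2h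

namespace DeformationDatum

variable {L : Type} [Field L] {V : Type} {Lv : V → Type} [∀ v, Field (Lv v)] {Y : V → Type}
  [∀ v, TopologicalSpace (Y v)] {K : (v : V) → Y v → Type} [∀ v y, Field (K v y)] [∀ v y, TopologicalSpace (K v y)]
  {G : V → Type} [∀ v, Group (G v)] {A : V → Type} [∀ v, Group (A v)]
  (D : DeformationDatum L V Lv Y K G A)

/-! ## §5.1 Equality of arithmeticoids (Lem. 5.1.2); tilts (Def. 5.1.7, Prop. 5.1.8); §5.2 Rmk. 5.2.2 -/

/-- **[J-2½] Lem. 5.1.2** (p.30 l.12–24): «Two arithmeticoids of `L` are equal if and only if for every `v ∈ V_L`, one has an isomorphism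
of untilts `(L_v ↪ K_v, K^♭_v ≃ L̂^♭_v) ≃ (L_v ↪ K′_v, K′^♭_v ≃ L̂^♭_v)`. Proof. This is clear from the definition.» DERIVED: in the signature a
point `y_v ∈ |Y_{F_v,L_v}|` IS an isomorphism class of untilts of `F_v` over `L_v` (Def. 4.1.1 / Def. 5.1.1 as typed in p430482, modelling
choice (e): «a point `y_v` IS the untilt datum, and distinct points index distinct data»), so «isomorphic untilts at every `v`» is
componentwise equality. [claim: Joshi2023ATS2half, status: disputed] -/
theorem lem512 (y₁ y₂ : D.Arith) : y₁ = y₂ ↔ ∀ v, y₁ v = y₂ v := funext_iff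

/-- **TILT SIGNATURE for [J-2½] Def. 5.1.1 / Def. 5.1.7** (HYPOTHESIS structure, nothing asserted): the tilting data that an arithmeticoid
carries and that `DeformationDatum` does not record — for each `v` the perfectoid base field `F_v = L̂^♭_v` («let `L̂_v` be the completion
of a fixed algebraic closure of `L_v`. Let `L̂^♭_v` be its tilt (for `v ∈ V^arc_L` this is Definition 2.3.3 [`(K^♭, |−|) = (K, |−|)`] and for
`v ∈ V^non_L` this is [Scholze, 2012])», §5.1 p.29 l.37–47), for each point `y_v` the tilt `K^♭_{y_v}` of its residue field, and the datum
«`K^♭_v ≃ L̂^♭_v`» of Def. 5.1.1 (p.29 l.49–58) as an isomorphism of topological rings; at `v ∈ V^non_L` the tilts have characteristic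
`p_v` ([Scholze 2012]; Def. 5.1.7 note (2) «factors which are of positive characteristic `p`»). Carriers are parameters (no instance declared).
[claim: Joshi2023ATS2half, status: disputed] -/
structure TiltDatum (F : V → Type) [∀ v, CommRing (F v)] [∀ v, TopologicalSpace (F v)] (Kflat : (v : V) → Y v → Type)
    [∀ v y, CommRing (Kflat v y)] [∀ v y, TopologicalSpace (Kflat v y)] : Type where
  /-- the tilting datum `K^♭_{y_v} ≃ F_v = L̂^♭_v` of the untilt `y_v` (Def. 5.1.1), a ring isomorphism … -/
  tiltIso : (v : V) → (y : Y v) → Kflat v y ≃+* F v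
  /-- … which is continuous … -/
  continuous_tiltIso : ∀ v y, Continuous (tiltIso v y)
  /-- … with continuous inverse (an isomorphism of topological rings; for the valued fields of §2.3 an isometry) -/
  continuous_tiltIso_symm : ∀ v y, Continuous (tiltIso v y).symm
  /-- the factors `K^♭_{y_v}` have characteristic `p_v` at non-archimedean `v` (Def. 5.1.7 note (2); [Scholze 2012]) -/
  charP_nonarch : ∀ v, v ∉ D.Varc → ∀ y : Y v, CharP (Kflat v y) (D.p v)

namespace TiltDatum

variable {D} {F : V → Type} [∀ v, CommRing (F v)] [∀ v, TopologicalSpace (F v)] {Kflat : (v : V) → Y v → Type}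
  [∀ v y, CommRing (Kflat v y)] [∀ v y, TopologicalSpace (Kflat v y)] (T : D.TiltDatum F Kflat)

/-- **[J-2½] Def. 5.1.7** (p.31 l.13–20): «Let `R_y` be the arithmetic ring of an arithmeticoid `arith(L)_y`. Then the TILT of the
arithmeticoid `arith(L)_y` is the topological ring given by `R^♭_y = ∏_{v ∈ V_L} K^♭_v`» (product ring, product topology). Note (1) (p.31
l.22–23): «should not be confused with tilting as defined in [Scholze, 2012], but the nomenclature is natural». [claim: Joshi2023ATS2half,
status: disputed] -/
abbrev tilt (_T : D.TiltDatum F Kflat) (y : D.Arith) : Type := (v : V) → Kflat v (y v)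

/-- Print's proof of **Prop. 5.1.8** (p.31 l.28–41): «using the tilting data `(K^♭ ≃ L̂^♭_v)_{v ∈ V_L}` of the arithmeticoid one obtains an
isomorphism `R^♭_y ≃ ∏_{v ∈ V_L} L̂^♭_v`» — the product of the tilting isomorphisms. [claim: Joshi2023ATS2half, status: disputed] -/
def tiltEquiv (y : D.Arith) : T.tilt y ≃+* ((v : V) → F v) := RingEquiv.piCongrRight fun v => T.tiltIso v (y v)

/-- `R^♭_y ≃ ∏_v F_v` is continuous (product of continuous maps). [folklore] -/
theorem continuous_tiltEquiv (y : D.Arith) : Continuous (T.tiltEquiv y) :=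
  continuous_pi fun v => (T.continuous_tiltIso v (y v)).comp (continuous_apply v)

/-- … and so is its inverse. [folklore] -/
theorem continuous_tiltEquiv_symm (y : D.Arith) : Continuous (T.tiltEquiv y).symm :=
  continuous_pi fun v => (T.continuous_tiltIso_symm v (y v)).comp (continuous_apply v)

/-- **[J-2½] Prop. 5.1.8** (p.31 l.26–41) DERIVED: «the topological isomorphism class of the tilt of any arithmeticoid `arith(L)_y` is
independent of the arithmeticoid `y`» — «since the topological ring on the right [`∏_v L̂^♭_v`] is independent of the choice of `y`». Stated
in the shape of E-t37's `TopEquivalent` (a ring isomorphism continuous in both directions). Rmk. 5.2.2 (3) (p.32 l.5–6) restates it.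
[claim: Joshi2023ATS2half, status: disputed] -/
theorem prop518 (y₁ y₂ : D.Arith) : ∃ e : T.tilt y₁ ≃+* T.tilt y₂, Continuous e ∧ Continuous e.symm :=
  ⟨(T.tiltEquiv y₁).trans (T.tiltEquiv y₂).symm,
    (T.continuous_tiltEquiv_symm y₂).comp (T.continuous_tiltEquiv y₁),
    (T.continuous_tiltEquiv_symm y₁).comp (T.continuous_tiltEquiv y₂)⟩

/-- **Def. 5.1.7 note (2)** (p.31 l.24–25) DERIVED: «The tilt of an arithmeticoid is a topological ring of characteristic zero because it has
factors which are of positive characteristic `p > 0` for any rational primes `p`» — typed with print's reason as the hypothesis that the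
residue characteristics `p_v` of the non-archimedean places are unbounded (for a number field every rational prime lies under some `v`): two
naturals with equal images in `R^♭_y` have equal images in a factor of prime characteristic exceeding both, hence are equal.
[claim: Joshi2023ATS2half, status: disputed] -/
theorem tilt_charZero (hV : ∀ N : ℕ, ∃ v, v ∉ D.Varc ∧ N < D.p v) (y : D.Arith) : CharZero (T.tilt y) := by
  refine ⟨fun m n hmn => ?_⟩
  obtain ⟨v, hv, hlt⟩ := hV (max m n)
  haveI := T.charP_nonarch v hv (y v)
  have h : (m : Kflat v (y v)) = n := by simpa using congr_fun hmn v
  exact CharP.natCast_injOn_Iio (Kflat v (y v)) (D.p v) (lt_of_le_of_lt (le_max_left m n) hlt)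
    (lt_of_le_of_lt (le_max_right m n) hlt) h

end TiltDatum

/-- **[J-2½] Rmk. 5.2.2 (1)** (p.32 l.1) DERIVED: «Evidently two topologically inequivalent arithmeticoids are inequivalent» (equivalence =
equality, p.30 l.6–9; topological equivalence = E-t37's `TopEquivalent`, Def. 5.2.1). (2) (p.32 l.2–4): «topological equivalence of
arithmeticoids ignores the tilting information completely and therefore is a weak notion … also a difficult notion to work with» — prose;
(3) = `TiltDatum.prop518`; (4) = Thm. 5.5.2 (7) = E-t37's claim `Thm552_7`. [claim: Joshi2023ATS2half, status: disputed] -/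
theorem ne_of_not_topEquivalent {y₁ y₂ : D.Arith} (h : ¬ D.TopEquivalent y₁ y₂) : y₁ ≠ y₂ := by
  rintro rfl
  exact h (TopEquivalent.refl D y₁)

/-! ## §5.5 Adeles and ideles of finite extensions inside the adeloid / ideloid (Prop. 5.5.1) -/

/-- **[J-2½] Prop. 5.5.1 (1)** (p.34 l.6–9): «Let `arith(L)` be an arithmeticoid. Then `arith(L)` provides an adeloid `𝔸_{arith(L)}` as well as
an ideloid `𝕀_{arith(L)}` of `L` [= E-t37's `adeloid` / `ideloid`, Def. 5.4.1]. Let `L′ ⊃ L` be a finite extension of `L`. Then (1) the adeloid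
`Adeloid_{arith(L)}` provides the ring `adeles(L′) ⊂ Adeloid_{arith(L)}` of adeles of `L′`»; «Proof. This is clear from the respective
definitions» (l.14). Typed as the existence of an injective ring homomorphism from Mathlib's adele ring of the number field `L′` into the
arithmetic ring `R_y`, landing in the adeloid and extending `ι_L` on `L ⊂ L′`. LOCATED for the faithfulness lane (no verdict): print gives
no construction of this embedding. [claim: Joshi2023ATS2half, status: disputed] -/
@[claim "Joshi2023ATS2half" "disputed"]
def Prop551_1 (L' : Type) [Field L'] [NumberField L'] [Algebra L L'] [FiniteDimensional L L'] : Prop :=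
  ∀ y : D.Arith, ∃ f : NumberField.AdeleRing (NumberField.RingOfIntegers L') L' →+* D.arithRing y,
    Function.Injective f ∧ Set.range f ⊆ D.adeloid y ∧
      ∀ x : L, f (algebraMap L' _ (algebraMap L L' x)) = D.iotaL y x

/-- **[J-2½] Prop. 5.5.1 (2)** (p.34 l.10–11): «(2) the ideloid `Ideloid_{arith(L)}` provides the group `ideles(L′) ⊂ Ideloid_{arith(L)}` of
`L′`» — typed as the existence of an injective group homomorphism from the ideles (units of Mathlib's adele ring of `L′`) into
`∏_v K_v*`, landing in E-t37's `ideloid` and extending `(ι_{y_v})_v` on `L*`. (3) (p.34 l.12–13): «The rings of adeles of `L` provided by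
two arithmeticoids may not be comparable as objects embedded in their respective arithmeticoids» — prose. LOCATED as (1).
[claim: Joshi2023ATS2half, status: disputed] -/
@[claim "Joshi2023ATS2half" "disputed"]
def Prop551_2 (L' : Type) [Field L'] [NumberField L'] [Algebra L L'] [FiniteDimensional L L'] : Prop :=
  ∀ y : D.Arith, ∃ f : (NumberField.AdeleRing (NumberField.RingOfIntegers L') L')ˣ →* ((v : V) → (K v (y v))ˣ),
    Function.Injective f ∧ Set.range f ⊆ D.ideloid y ∧
      ∀ x : Lˣ, f (Units.map (algebraMap L' _).toMonoidHom (Units.map (algebraMap L L').toMonoidHom x)) = D.iotaUnits y x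

/-! ## §5.8 Deformations of a number field (Def. 5.8.1, Rmk. 5.8.3) -/

/-- The `v`-component `ι_{L̄,v} : L̄ → K_{y_v}` of Def. 5.8.1 (2)'s `ι_{L̄}`, CONSTRUCTED from «`K_v` is an algebraically closed perfectoid
field» (Def. 5.1.1 p.29 l.49–58; Thm. 5.5.2 (3)–(4) proof p.34 l.32–35: «a preferred algebraic closure of `L_v` namely the algebraic closure
`L̄_v ⊂ K_v`») by extending `ι_{y_v} : L → K_{y_v}` to an algebraic closure `L̄` of `L` (Mathlib `IsAlgClosed.lift`; a choice).
[claim: Joshi2023ATS2half, status: disputed] -/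
def iotaBarAt (y : D.Arith) (v : V) [IsAlgClosed (K v (y v))] (Lbar : Type) [Field Lbar] [Algebra L Lbar] [IsAlgClosure L Lbar] :
    Lbar →+* K v (y v) :=
  letI : Algebra L (K v (y v)) := (D.iota y v).toAlgebra
  (IsAlgClosed.lift : Lbar →ₐ[L] K v (y v)).toRingHom

/-- `ι_{L̄,v}` extends `ι_{y_v}`. [folklore] -/
theorem iotaBarAt_algebraMap (y : D.Arith) (v : V) [IsAlgClosed (K v (y v))] (Lbar : Type) [Field Lbar] [Algebra L Lbar]
    [IsAlgClosure L Lbar] (x : L) : D.iotaBarAt y v Lbar (algebraMap L Lbar x) = D.iota y v x := by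
  letI : Algebra L (K v (y v)) := (D.iota y v).toAlgebra
  change (IsAlgClosed.lift : Lbar →ₐ[L] K v (y v)) (algebraMap L Lbar x) = algebraMap L (K v (y v)) x
  exact AlgHom.commutes _ x

/-- **[J-2½] Def. 5.8.1** (p.36 l.11–27): «An ARITHMETIC DEFORMATION of a number field `L` is the choice of an arithmeticoid `arith(L)_y` for
some point `y ∈ 𝒴_L`. This comes equipped with (1) an embedding `ι_L : L ↪ arith(L)_y`, and (2) an embedding `ι_{L̄} : L̄ ↪ arith(L)_y`, and
(3) for every finite extension `L′` of `L`, an adeloid `𝔸_{arith(L′)_y}`, and (4) an ideloid `𝕀_{arith(L′)_y}`. (5) Each `arith(L)` is also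
equipped with an intrinsic copy of the absolute Galois group `G_L` and the group `𝔾_L`»; (5.8.2): «valuations … can be normalized so that …
`∏_v |x|^{α_v}_{K_v} = 1`». PACKAGING over E-t37's carriers: the point `y` and the DATUM (2) — an embedding of an algebraic closure `L̄` of
`L` (a parameter) into `R_y` extending `ι_L` (Lem. 5.1.3 p.30 l.26–45: «`R` contains `L̄` as an embedded subring … I will denote the
embedding … `ι_{L̄} : L̄ ↪ arith(L)`»); (1), (3)–(5) and (5.8.2) are the derived members below. Rmk. 5.1.4 (p.30 l.50–51): «One should think
of an arithmeticoid of `arith(L)` as providing a copy of the arithmetic of `L` and `L̄`»; Rmk. 5.8.3 (p.36 l.28–30): «Thanks to the last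
assertion of Theorem 6.2.1 [seat E-t38's claim `Summit.ABC.IUTFork.Joshi.ATS2half.Thm621`, p430039] one can say that arithmeticoids of `L`
provide isomorphs of a number field `L` and its algebraic closure `L̄` which may even be topologically distinguished from each other».
[claim: Joshi2023ATS2half, status: disputed] -/
structure Deformation (Lbar : Type) [Field Lbar] [Algebra L Lbar] [IsAlgClosure L Lbar] : Type where
  /-- the chosen arithmeticoid `arith(L)_y`, `y ∈ 𝒴_L` -/
  pt : D.Arith
  /-- (2) `ι_{L̄} : L̄ ↪ arith(L)_y` -/
  iotaBar : Lbar →+* D.arithRing pt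
  /-- `ι_{L̄}` extends `ι_L` -/
  iotaBar_algebraMap : ∀ x : L, iotaBar (algebraMap L Lbar x) = D.iotaL pt x

namespace Deformation

variable {D} {Lbar : Type} [Field Lbar] [Algebra L Lbar] [IsAlgClosure L Lbar] (Δ : D.Deformation Lbar)

/-- Def. 5.8.1 (1): `ι_L : L ↪ arith(L)_y` (= E-t37's `iotaL`). [claim: Joshi2023ATS2half, status: disputed] -/
def iotaL : L →+* D.arithRing Δ.pt := D.iotaL Δ.pt

/-- Def. 5.8.1 (3) for `L′ = L`: the adeloid `𝔸_{arith(L)_y}` (E-t37's `adeloid`, Def. 5.4.1; for `L′ ⊋ L` see `Prop551_1`).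
[claim: Joshi2023ATS2half, status: disputed] -/
def adeloid : Set (D.arithRing Δ.pt) := D.adeloid Δ.pt

/-- Def. 5.8.1 (4) for `L′ = L`: the ideloid `𝕀_{arith(L)_y}` (E-t37's `ideloid`; for `L′ ⊋ L` see `Prop551_2`). [claim: Joshi2023ATS2half,
status: disputed] -/
def ideloid : Subgroup ((v : V) → (K v (Δ.pt v))ˣ) := D.ideloid Δ.pt

/-- Def. 5.8.1 (5), first half: the «intrinsic copy of the absolute Galois group `G_L`» — the automorphism group of the algebraic closure `L̄`
the deformation embeds (Thm. 5.5.2 (1)–(2): «an isomorph `G_{L;y}` of `G_L`»). [claim: Joshi2023ATS2half, status: disputed] -/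
abbrev galoisGroup (_Δ : D.Deformation Lbar) : Type := Lbar ≃ₐ[L] Lbar

/-- Def. 5.8.1 (5), second half: «… and the group `𝔾_L`» — read as the decorated group `𝔾_L = ∏_v G_v` of (4.2.1) (E-t37's `GalProd`;
Thm. 5.5.2 (5) «a preferred isomorph of the product group»); LOCATED: the render's text layer does not distinguish `G_L` from `𝔾_L` (p.36
l.18–19), cf. seat E-t38's note on p430482. [claim: Joshi2023ATS2half, status: disputed] -/
abbrev decoratedGalois (_Δ : D.Deformation Lbar) : Type := D.GalProd

/-- **(5.8.2)** (p.36 l.20–27) DERIVED: in the normalized deformation «for all `x ∈ L*` one has `∏_v |x|^{α_v}_{K_v} = 1`» — E-t37's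
`prod_formula_normalized` ((5.3.4)) read on the deformation, in logarithmic form. [claim: Joshi2023ATS2half, status: disputed] -/
theorem prod_formula (x : Lˣ) : ∑ᶠ v, D.α v (Δ.pt v) * Real.log (D.absK v (Δ.pt v) (D.iota Δ.pt v x)) = 0 :=
  D.prod_formula_normalized Δ.pt x

end Deformation

/-- Def. 5.8.1 (2) / **Lem. 5.1.3** REALISED (p.30 l.26–45: «its arithmetic ring `∏_v K_v` contains an algebraic closure `L̄` of the embedded
subfield `L`»): when every residue field `K_{y_v}` is algebraically closed (Def. 5.1.1), every arithmeticoid carries the structure of an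
arithmetic deformation — `ι_{L̄} := (ι_{L̄,v})_v`. DERIVED (a construction by choice, as print's «a preferred algebraic closure»).
[claim: Joshi2023ATS2half, status: disputed] -/
def deformationOf [∀ v (y : Y v), IsAlgClosed (K v y)] (Lbar : Type) [Field Lbar] [Algebra L Lbar] [IsAlgClosure L Lbar]
    (y : D.Arith) : D.Deformation Lbar where
  pt := y
  iotaBar := RingHom.pi fun v => D.iotaBarAt y v Lbar
  iotaBar_algebraMap x := by
    funext v
    exact D.iotaBarAt_algebraMap y v Lbar x

/-- The deformation structure on `y` has underlying arithmeticoid `y`. [folklore] -/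
@[simp] theorem deformationOf_pt [∀ v (y : Y v), IsAlgClosed (K v y)] (Lbar : Type) [Field Lbar] [Algebra L Lbar]
    [IsAlgClosure L Lbar] (y : D.Arith) : (D.deformationOf Lbar y).pt = y := rfl

/-- `ι_{L̄}` is injective as soon as `V_L ≠ ∅` (a ring map out of a field into a non-trivial ring). [folklore] -/
theorem iotaBar_injective [Nonempty V] {Lbar : Type} [Field Lbar] [Algebra L Lbar] [IsAlgClosure L Lbar] (Δ : D.Deformation Lbar) :
    Function.Injective Δ.iotaBar := fun _ _ h =>
  ((Pi.evalRingHom (fun v => K v (Δ.pt v)) (Classical.arbitrary V)).comp Δ.iotaBar).injective (congr_fun h (Classical.arbitrary V))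

/-! ## §5.9 The global Frobenius of `L` (Rmk. 5.9.2) and §5.10 tuples of period hyperplanes (Rmk. 5.10.2) -/

/-- **[J-2½] Rmk. 5.9.2** (p.37 l.16–21): «The properties of `L ↦ L^{(1)}` are easily established using Theorem 4.2.3, Corollary 4.2.5,
Corollary 5.6.2 and Remark 4.2.6. Notably, by Corollary 4.2.5, the relationship between the local multiplicative structures corresponding
to `L` and `L^{(1)}` is through the `p_v`-th power mapping for each `v ∈ V_L`» (Cor. 5.6.2's monoids `K̃` of §3.1 are not typed on the
S-spine, E-PLAN R11). One such property DERIVED modulo E-t37's claim `LActsByFrobeniusPowers` (Thm. 4.2.3 (4), Rmk. 4.2.6 (1)–(2) p.24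
l.8–19): the global Frobenius `L ↦ L^{(1)}` (Def. 5.9.1, E-t37's `Lone`) commutes with the action `L* ↷ 𝒴_L` — both act through powers of
`ϕ_v` at `v ∈ V^non`, and `ϕ_v = 1` at `v ∈ V^arc`. [claim: Joshi2023ATS2half, status: disputed] -/
theorem Lone_unitAction (h : D.LActsByFrobeniusPowers) (x : Lˣ) (y : D.Arith) :
    D.Lone (D.unitAction x y) = D.unitAction x (D.Lone y) := by
  funext v
  simp only [Lone_apply, unitAction_apply]
  by_cases hv : v ∈ D.Varc
  · simp [D.frob_arch v hv]
  · rw [h v hv x, ← Homeomorph.mul_apply, ← Homeomorph.mul_apply, (Commute.self_zpow (D.frob v) _).eq]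

/-- **[J-2½] Rmk. 5.10.2 (2)** (p.39 l.3–15): «In the context of the proof of [Mochizuki, 2021c, Corollary 3.12] (where … one takes `L` to be
`L_mod`) given in [Joshi, 2024], one works with tuples of arithmeticoids `(y_1, …, y_{ℓ*}) ∈ Σ_L ⊂ 𝒴^{ℓ*}_L` and this gives a tuple of
hyperplanes `(H_{y_1}, …, H_{y_{ℓ*}})` arising from the `ℓ*`-tuple of ideloids … The above proposition remains valid even for this case of
`ℓ*`-tuples» — the tuple of E-t37's period hyperplanes (Thm. 5.10.1 (7) `periodMap`). LOCATED, recorded verbatim, NO ADJUDICATION (an E6 /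
barrier attach point of `HOME/plan/E/JOSHI-DAG.md`): (1) «the fundamental period mapping of Arithmetic Teichmuller Theory of Number Fields»;
(3) «The relationship between the coordinates of `(H_{y_1}, …, H_{y_{ℓ*}})` is given by the scaling relationship [Joshi, 2024, Theorem
4.2.2.1]» (seat E-t7's `Joshi/AdelicAnsatzScaling.lean`); (4) «in the context of [Mochizuki, 2021c, Corollary 3.12] Mochizuki considers
(without a transparent proof) a version of this construction by means of the theory of realified Frobenioid `Frob(L)^ℝ` … the tuple of
realified Frobenioids `(Frob(L)^ℝ_1, …, Frob(L)^ℝ_{ℓ*})` which provides, by the same degree mapping, the hyperplanes considered here»;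
(5) «The existence of the phenomenon and properties established by Theorem 5.10.1 is vital to establishing [Mochizuki, 2021c, Corollary
3.12]. But this type of proposition is claimed without proof in [Mochizuki, 2021c], [Tan, 2018], [Yamashita, 2019]. Notably, because of the
scaling property [Joshi, 2024, Theorem 4.2.2.1], the hyperplane `H_{y_j}` comes equipped with a scaling factor of `j²` … The lack of proof
of this property in [Mochizuki, 2021c] leads to the assertions of impossibility of this phenomenon in [Scholze and Stix, 2018, Section 2.2,
Page 10]» (p.39 l.16–34). [claim: Joshi2023ATS2half, status: disputed] -/
def periodTuple {n : ℕ} (ys : Fin n → D.Arith) : Fin n → Set (V →₀ ℝ) := fun j => D.periodMap (ys j)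

/-- Thm. 5.10.1 (6) on tuples («the above proposition remains valid even for this case of `ℓ*`-tuples», p.39 l.15): acting by `x ∈ L*`
diagonally moves `(H_{y_j})_j` to `(H_{x·y_j})_j` — definitionally, as E-t37's `periodMap_unitAction`. [claim: Joshi2023ATS2half, status:
disputed] -/
theorem periodTuple_unitAction {n : ℕ} (x : Lˣ) (ys : Fin n → D.Arith) :
    D.periodTuple (fun j => D.unitAction x (ys j)) = fun j => D.hyperplane (D.unitAction x (ys j)) := rfl

/-! ## §5.11 Parameter spaces (Thm. 5.11.1); §5.12 anabelomorphic deformations (Thm. 5.12.1) -/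

/-- **[J-2½] Thm. 5.11.1** (p.39 l.38–47) DERIVED: «Let `L` be a number field with no real embeddings. Then `𝒴_L`, `𝒴^max_L` and `𝒴^ℝ_L` are
all metrisable parameter spaces of arithmeticoids of `L` i.e. notably `𝒴_L` is a metrisable space parameterizing deformations of `L`.
Proof. … arithmeticoids of `L` are parameterized by points of `𝒴_L` and its metrisability was proved in Theorem 5.1.5. The assertion for
`𝒴^max_L` and `𝒴^ℝ_L` is also clear from this» — E-t37's `ycal_metrizable` holds for every base tag (Def. 4.1.1 / 4.7.1 / 4.8.1, and Rmk.
4.1.3's `𝒴′_L`). Rmk. 5.11.2 (p.39 l.48–50): «the number field analog of the well-known fact that the classical Teichmuller space is a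
metrisable parameter space for Riemann surfaces [Imayoshi and Taniguchi, 1992]»; Rmk. 5.1.6 (p.31 l.9–12): «one can quantify quite
naturally, how the arithmetic of `L` presented by `arith(L)_{y₁}` is different from that presented by `arith(L)_{y₂}`. Ultimately the idea of
[Mochizuki, 2021a,b,c,d] is that one wants to average over different ways of doing arithmetic». [claim: Joshi2023ATS2half, status: disputed] -/
theorem thm5111 : (D.IsDef411 ∨ D.IsRmk413 ∨ D.IsDef471 ∨ D.IsDef481) ∧ MetrizableSpace D.Arith := by
  refine ⟨?_, D.arith_metrizable⟩
  rcases h : D.base <;> simp [IsDef411, IsRmk413, IsDef471, IsDef481, h]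

/-- The embedded number field `L_i := ι_L(L) ⊂ arith(L)_{y_i}` of Thm. 5.12.1 (p.40 l.5: «write `L_i ⊂ arith(L)_{y_i}` for the embedded number
subfield `L`»), a subring of `R_y`. [claim: Joshi2023ATS2half, status: disputed] -/
def embeddedL (y : D.Arith) : Subring (D.arithRing y) := (D.iotaL y).range

/-- `ι_L : L → R_y` is injective as soon as `V_L ≠ ∅`. [folklore] -/
theorem iotaL_injective [Nonempty V] (y : D.Arith) : Function.Injective (D.iotaL y) := fun _ _ h =>
  (D.iota y (Classical.arbitrary V)).injective (congr_fun h (Classical.arbitrary V))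

/-- `L ≃ L_i`: `ι_L` co-restricted to its image. [folklore] -/
def embeddedLEquiv [Nonempty V] (y : D.Arith) : L ≃+* D.embeddedL y :=
  RingEquiv.ofBijective (D.iotaL y).rangeRestrict
    ⟨fun _ _ h => D.iotaL_injective y (Subtype.ext_iff.mp h), (D.iotaL y).rangeRestrict_surjective⟩

/-- **[J-2½] Thm. 5.12.1 (1)** (p.40 l.7–13): «the isomorphism of `G_{L₁} ≃ G_L ≃ G_{L₂}` provides an isomorphism of the multiplicative
monoids `L*₁ ≃ L* ≃ L*₂`». DERIVED as the ring isomorphism `L₁ ≃ L ≃ L₂` of the embedded copies (it restricts to the multiplicative monoids),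
which in the signature comes from the common source `L`. LOCATED (no verdict): print's ground is different — «a consequence of the fact
that the monoid `L*` is amphoric (see [Joshi, 2020a]) i.e. an invariant of the isomorphism class of the topological group `Gal(L̄/L)` …
[Hoshi, 2015]» (proof p.40 l.27–30; seat E-t38's claim `Summit.ABC.IUTFork.Joshi.ATS2half.Prop422` / `GlobalGaloisIsomorphic` type that
side). (3) (p.40 l.19–21): «there may be no topological isomorphism of `K_{1,v} ≃ K_{2,v}` and hence no isomorphism between `L₁ ↪ L_{1,v}`
and `L₂ ↪ L_{2,v}` compatible with their embeddings» = E-t37's claim `LocalTopInequivalent`; (4) «need not be equivalent and need not even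
be topologically equivalent» = E-t37's `Thm552_7`; (5) «the difference … can be quantified by means of Theorem 5.1.5» = `arith_metrizable`.
Rmk. 5.12.2 (p.40 l.33 – p.41 l.4): «(1) arithmeticoids provide topological deformations of a number field … each arithmeticoid provides an
avatar of the number field in which its field arithmetic is slightly different …; (2) … differences between two such avatars of `L` can be
quantified by means of Lemma 4.1.2; (3) … An arithmeticoid of `L` is an anabelomorphic deformation of the arithmetic of the number field
`L`». [claim: Joshi2023ATS2half, status: disputed] -/
def thm5121_1 [Nonempty V] (y₁ y₂ : D.Arith) : D.embeddedL y₁ ≃+* D.embeddedL y₂ :=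
  (D.embeddedLEquiv y₁).symm.trans (D.embeddedLEquiv y₂)

/-- `L₁* ≃ L₂*` literally: the ring isomorphism on units. [claim: Joshi2023ATS2half, status: disputed] -/
def thm5121_1_units [Nonempty V] (y₁ y₂ : D.Arith) : (D.embeddedL y₁)ˣ ≃* (D.embeddedL y₂)ˣ := Units.mapEquiv (D.thm5121_1 y₁ y₂)

/-- The embedded local field `L_{i,v} := ι_{y_v}(L_v) ⊂ K_{i,v}` of Thm. 5.12.1 (p.40 l.5–6: «for any `v ∈ V_L`, write `L_{i,v}` for the
embedded `L_v`»). [claim: Joshi2023ATS2half, status: disputed] -/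
def embeddedLv (y : D.Arith) (v : V) : Subring (K v (y v)) := (D.emb v (y v)).range

/-- `L_v ≃ L_{i,v}`: the untilt structure map co-restricted to its image (a field embedding is injective). [folklore] -/
def embeddedLvEquiv (y : D.Arith) (v : V) : Lv v ≃+* D.embeddedLv y v :=
  RingEquiv.ofBijective (D.emb v (y v)).rangeRestrict
    ⟨fun _ _ h => (D.emb v (y v)).injective (Subtype.ext_iff.mp h), (D.emb v (y v)).rangeRestrict_surjective⟩

/-- **[J-2½] Thm. 5.12.1 (2), algebraic part** (p.40 l.14–18) DERIVED: «for each `v ∈ V_L` the isomorphism `G_{L₁,v} ≃ G_{L₂,v}` provides an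
isomorphism of the topological monoids `L*_{1,v} ≃ L*_{2,v}`» — the ring isomorphism `L_{1,v} ≃ L_v ≃ L_{2,v}` (restricting to units); the
word «topological» is the claim `Thm5121_2_top`. LOCATED as in (1). [claim: Joshi2023ATS2half, status: disputed] -/
def thm5121_2 (y₁ y₂ : D.Arith) (v : V) : D.embeddedLv y₁ v ≃+* D.embeddedLv y₂ v :=
  (D.embeddedLvEquiv y₁ v).symm.trans (D.embeddedLvEquiv y₂ v)

/-- **[J-2½] Thm. 5.12.1 (2), topological clause** (p.40 l.14–18): the monoid isomorphism `L*_{1,v} ≃ L*_{2,v}` is one of TOPOLOGICAL monoids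
for the topologies induced from `K_{1,v}`, `K_{2,v}` (the signature does not tie the topology of `K_y` to `|−|_{K_y}`, so this is not derived
here). [claim: Joshi2023ATS2half, status: disputed] -/
@[claim "Joshi2023ATS2half" "disputed"]
def Thm5121_2_top : Prop :=
  ∀ (y₁ y₂ : D.Arith) (v : V), ∃ e : D.embeddedLv y₁ v ≃+* D.embeddedLv y₂ v, Continuous e ∧ Continuous e.symm

end DeformationDatum

end Summit.ABC.IUTFork.Joshi.ATS2h
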